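import Summits.QuantumFields.BalabanUV.T4Continuum.Support.LatticeCosineProfile
import Summits.QuantumFields.BalabanUV.T4Continuum.Support.HolonomyTowerRegularBridge
import Summits.QuantumFields.BalabanUV.T4Continuum.Spine.NE2.AdjointFieldInstance
import Summits.QuantumFields.BalabanUV.T4Continuum.Spine.NE2.DeltaPrimeOperator
import Literature.Analysis.FunctionSpaces.TorusSobolevNormHolderProofs

/-!
# T⁴ programme, spine node NE2 (U1a) — A CURVED WITNESS FOR THE ONE-BINDER END: THE TRANSVERSE `U(1)`-PHASE WAVE LIES IN `RegularSites`
# (cell `pub-balaban-gaps`, seat ne2 gen 3, file 5a; companion of `Spine/NE2/AdjointFieldRegularity` and of the flat witness `Spine/NE2/RegularGaugeFieldWitness`)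

`Spine/NE2/AdjointFieldRegularity.balaban326_rate_of_regularGaugeField` carries ONE regularity binder on the data, `RegularSites L M V α₁ β₁ β₂` (size / lattice-Lipschitz /
second differences of the bond variables — the (3.35)+(3.36) shapes).  The flat witness `V ≡ 1` discharges it with `0 0 0` but has `Δ′ = 0`.  THIS FILE exhibits a tower of
`U(N)` lattice gauge fields with NON-ZERO curvature in that class: the transverse `U(1)`-phase wave
  `V_k(ν, x) = exp(i·t_k(ν, x))·1`,  `t_k(ν, x) = [ν = ν₀]·(θ/c_k)·cos(2π·val(x_{μ₀})/(c_k·M_{μ₀}))`  (**`cwave`**; `c_k = L^k`; the profile `LatticeCosineProfile.cang` of row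
B5's wave witness `NE2BalabanWaveWitness`, here in the CENTRE of `U(N)` so that `Ad ∘ V ≡ 1`), and proves **`regularSites_cwave`**:
  `RegularSites L M V |θ| (2π|θ|/M_{μ₀}) (4π²(|θ| + θ²)/M_{μ₀}²)`  for `M_{μ₀} ≥ 3`
— size from `|e^{it} − 1| ≤ |t|`, lattice-Lipschitz from `|e^{ia} − e^{ib}| ≤ |a − b|` (`Literature.Analysis.FunctionSpaces.Torus.norm_cexp_I_mul_sub_cexp_I_mul_le`) and one lattice step of the profile (`abs_cang_add_one_sub_le`), the SECOND-DIFFERENCE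
letter from the unit-phase identity `e^{ia} − 2e^{ib} + e^{ic} = (e^{ib} − e^{ic})(e^{i(a−b)} − 1) + e^{ic}(e^{i(a−b)} − e^{i(b−c)})` (**`norm_cexp_second_diff_le`**) and the cosine's
second difference `|cos(α + 2h) − 2cos(α + h) + cos α| ≤ h²` (**`abs_cos_second_diff_le`**); §1 also records the second-order Taylor bound **`abs_cos_add_sub_cos_add_mul_sin_le`**
(`|cos(α + h) − cos α + h sin α| ≤ h²`, `|h| ≤ 1`) used by the curvature companion (file 5b: the field strength of the wave, its NE3-type two-level consistency, `Ad ∘ V = 1`,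
and the END instance).
HONEST FRAMING (T4-DAG p. 1).  A TOY member of the data class (abelian-type transverse wave in the centre of `U(N)`; OURS); elementary trigonometry on the tree's finite tori; GLOBAL
small field; asserts NOTHING about Bałaban's minimisers, node NE3, or (3.35)/(3.36) as theorems about them; NE2 (U1a) NOT PROVED; spine PROVED 0/9 unchanged; NOT continuum YM /
infinite volume / mass gap / Clay.  HONEST DEPENDENCY: continuum YM on T⁴ ⇐ BetaPertH ∧ nine spine estimates (0/9 proved); BetaPertH ⇐ (D1) ∧ (D4) ∧ CAP+tail; G-an2-4
gates asym, D1 and NE2/3/4.  No `sorry`.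
-/

noncomputable section

open scoped BigOperators ComplexConjugate Matrix Real

namespace Summit.QuantumFields.BalabanUV.T4Continuum.NE2.RegularGaugeFieldWave

open scoped Kronecker Matrix.Norms.L2Operator
open Literature.MathematicalPhysics.QuantumFieldTheory.Balaban1983to89.B5Prop11Plancherel (Tor fine unitVec)
open Literature.MathematicalPhysics.QuantumFieldTheory.Balaban1983to89.B5G183RateUnitTower (lev lev_neZero)
open Summit.QuantumFields.BalabanUV.T4Continuum
open Summit.QuantumFields.BalabanUV.T4Continuum.BalabanAveragedTowerUnit (idx one_le_lev' lev_succ')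
open Summit.QuantumFields.BalabanUV.T4Continuum.BalabanAveragedTowerModes (par val_par)
open Summit.QuantumFields.BalabanUV.T4Continuum.BlockPairingGeometry (tau)
open Summit.QuantumFields.BalabanUV.T4Continuum.RegularBackgroundTower (lev_pos)
open Summit.QuantumFields.BalabanUV.T4Continuum.HolonomyTowerRegular (RegularSites wT DqT)
open Summit.QuantumFields.BalabanUV.T4Continuum.LatticeCosineProfile (cang abs_cang_le cang_add abs_cang_add_one_sub_le abs_cang_sub_cang_par_le)
open Literature.Analysis.FunctionSpaces.Torus (norm_cexp_I_mul_sub_cexp_I_mul_le)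

/-! ## §1 Three elementary trigonometric bounds -/

/-- second-order Taylor bound of the cosine: `|cos(α + h) − cos α + h·sin α| ≤ h²` for `|h| ≤ 1`. [folklore] -/
theorem abs_cos_add_sub_cos_add_mul_sin_le (α : ℝ) {h : ℝ} (hh : |h| ≤ 1) : |Real.cos (α + h) - Real.cos α + h * Real.sin α| ≤ h ^ 2 := by
  have hc := Real.cos_bound hh
  have hs := Real.sin_bound hh
  have ha0 := abs_nonneg h
  have hsq : |h| ^ 2 = h ^ 2 := sq_abs h
  have h1 : |h| ^ 2 ≤ 1 := pow_le_one₀ ha0 hh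
  have h4 : |h| ^ 4 ≤ h ^ 2 := by
    rw [← hsq, show (4 : ℕ) = 2 + 2 from rfl, pow_add]; exact mul_le_of_le_one_left (sq_nonneg _) h1
  have h5 : |h| ^ 5 ≤ h ^ 2 := by
    rw [← hsq, show (5 : ℕ) = 3 + 2 from rfl, pow_add]; exact mul_le_of_le_one_left (sq_nonneg _) (pow_le_one₀ ha0 hh)
  have h3 : |h| ^ 3 ≤ h ^ 2 := by
    rw [← hsq, show (3 : ℕ) = 1 + 2 from rfl, pow_add, pow_one]; exact mul_le_of_le_one_left (sq_nonneg _) hh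
  rw [Real.cos_add]
  have e : Real.cos α * Real.cos h - Real.sin α * Real.sin h - Real.cos α + h * Real.sin α
      = Real.cos α * (Real.cos h - (1 - h ^ 2 / 2)) - Real.sin α * (Real.sin h - (h - h ^ 3 / 6)) - Real.cos α * (h ^ 2 / 2)
        + Real.sin α * (h ^ 3 / 6) := by
    ring
  rw [e]
  have hca := Real.abs_cos_le_one α
  have hsa := Real.abs_sin_le_one α
  have t1 : |Real.cos α * (Real.cos h - (1 - h ^ 2 / 2))| ≤ |h| ^ 4 * (5 / 96) := by
    rw [abs_mul]
    calc |Real.cos α| * |Real.cos h - (1 - h ^ 2 / 2)| ≤ 1 * (|h| ^ 4 * (5 / 96)) := by gcongr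
      _ = |h| ^ 4 * (5 / 96) := one_mul _
  have t2 : |Real.sin α * (Real.sin h - (h - h ^ 3 / 6))| ≤ |h| ^ 5 / 100 := by
    rw [abs_mul]
    calc |Real.sin α| * |Real.sin h - (h - h ^ 3 / 6)| ≤ 1 * (|h| ^ 5 / 100) := by gcongr
      _ = |h| ^ 5 / 100 := one_mul _
  have t3 : |Real.cos α * (h ^ 2 / 2)| ≤ h ^ 2 / 2 := by
    rw [abs_mul, abs_of_nonneg (by positivity : (0:ℝ) ≤ h ^ 2 / 2)]
    exact mul_le_of_le_one_left (by positivity) hca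
  have t4 : |Real.sin α * (h ^ 3 / 6)| ≤ |h| ^ 3 / 6 := by
    rw [abs_mul, abs_div, abs_pow, abs_of_pos (by norm_num : (0:ℝ) < 6)]
    calc |Real.sin α| * (|h| ^ 3 / 6) ≤ 1 * (|h| ^ 3 / 6) := by gcongr
      _ = |h| ^ 3 / 6 := one_mul _
  have tri : |Real.cos α * (Real.cos h - (1 - h ^ 2 / 2)) - Real.sin α * (Real.sin h - (h - h ^ 3 / 6)) - Real.cos α * (h ^ 2 / 2)
        + Real.sin α * (h ^ 3 / 6)|
      ≤ |Real.cos α * (Real.cos h - (1 - h ^ 2 / 2))| + |Real.sin α * (Real.sin h - (h - h ^ 3 / 6))| + |Real.cos α * (h ^ 2 / 2)|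
        + |Real.sin α * (h ^ 3 / 6)| := by
    refine (abs_add_le _ _).trans (add_le_add ((abs_sub _ _).trans (add_le_add (abs_sub _ _) le_rfl)) le_rfl)
  nlinarith [sq_nonneg h]

/-- second difference of the cosine: `|cos(α + 2h) − 2cos(α + h) + cos α| ≤ h²`. [folklore] -/
theorem abs_cos_second_diff_le (α h : ℝ) : |Real.cos (α + 2 * h) - 2 * Real.cos (α + h) + Real.cos α| ≤ h ^ 2 := by
  have e : Real.cos (α + 2 * h) - 2 * Real.cos (α + h) + Real.cos α = 2 * Real.cos (α + h) * (Real.cos h - 1) := by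
    have h1 : Real.cos (α + 2 * h) = Real.cos ((α + h) + h) := by ring_nf
    have h2 : Real.cos α = Real.cos ((α + h) - h) := by ring_nf
    rw [h1, h2, Real.cos_add, Real.cos_sub]; ring
  rw [e, abs_mul, abs_mul, abs_two]
  have hc : |Real.cos (α + h)| ≤ 1 := Real.abs_cos_le_one _
  have h1c : |Real.cos h - 1| ≤ h ^ 2 / 2 := by
    rw [abs_sub_comm, abs_of_nonneg (by linarith [Real.cos_le_one h])]
    linarith [Real.one_sub_sq_div_two_le_cos (x := h)]
  calc 2 * |Real.cos (α + h)| * |Real.cos h - 1| ≤ 2 * 1 * (h ^ 2 / 2) := by gcongr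
    _ = h ^ 2 := by ring

/-! ## §2 Scalar unitaries and the transverse U(1)-phase wave -/

section Wave

variable {n : Type} [Fintype n] [DecidableEq n] {d : ℕ}

/-- `‖c·1‖ = ‖c‖` on a non-empty matrix algebra. [folklore] -/
theorem norm_smul_one_eq [Nonempty n] (c : ℂ) : ‖c • (1 : Matrix n n ℂ)‖ = ‖c‖ := by
  rw [norm_smul, norm_one, mul_one]

/-- `e^{it}` has norm-square one: `conj(e^{it})·e^{it} = 1`. [folklore] -/
theorem conj_cexp_mul_cexp (t : ℝ) : (starRingEnd ℂ) (Complex.exp (Complex.I * t)) * Complex.exp (Complex.I * t) = 1 := by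
  rw [← Complex.normSq_eq_conj_mul_self, Complex.normSq_eq_norm_sq, Complex.norm_exp_I_mul_ofReal]; norm_num

/-- **the scalar unitary `e^{it}·1 ∈ U(N)`**. [folklore] -/
def uphase (t : ℝ) : Matrix.unitaryGroup n ℂ :=
  ⟨Complex.exp (Complex.I * t) • (1 : Matrix n n ℂ), by
    rw [Matrix.mem_unitaryGroup_iff']
    rw [star_smul, star_one, Matrix.smul_mul, Matrix.one_mul, smul_smul, Complex.star_def, conj_cexp_mul_cexp, one_smul]⟩

/-- unfolding. [folklore] -/
theorem uphase_coe (t : ℝ) : ((uphase t : Matrix.unitaryGroup n ℂ) : Matrix n n ℂ) = Complex.exp (Complex.I * t) • (1 : Matrix n n ℂ) := rfl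

/-- `uphase 0 = 1`. [folklore] -/
theorem uphase_zero : (uphase 0 : Matrix.unitaryGroup n ℂ) = 1 := by
  apply Subtype.ext
  rw [uphase_coe, Complex.ofReal_zero, mul_zero, Complex.exp_zero, one_smul]; rfl

variable (L : ℕ) [NeZero L] (M : Fin d → ℕ) [hM : ∀ μ, NeZero (M μ)]

/-- the phase profile of the wave: `t_k(ν, x) = [ν = ν₀]·(θ/c_k)·cos(2π·val(x_{μ₀})/(c_k·M_{μ₀}))` — a smooth `1`-periodic transverse profile of the PHYSICAL coordinate
read on each lattice of the tower; amplitude `θ/c_k` = «η·A» with `|A| ≤ θ` (the (3.35) size shape). [folklore] -/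
def tw (θ : ℝ) (ν₀ μ₀ : Fin d) (k : ℕ) (ν : Fin d) (x : Tor (fine (lev L k) M)) : ℝ :=
  if ν = ν₀ then θ / (lev L k : ℕ) * cang (fine (lev L k) M μ₀) (x μ₀) else 0

/-- **THE TRANSVERSE `U(1)`-PHASE WAVE**: `V_k(ν, x) = e^{i t_k(ν,x)}·1 ∈ U(N)` — bond variables along `ν₀` modulated along `μ₀`; for `ν₀ ≠ μ₀` its `(μ₀, ν₀)`-plaquettes
carry NON-ZERO curvature. A TOY member of the data class (OURS), nothing of Bałaban's. [folklore] -/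
def cwave (θ : ℝ) (ν₀ μ₀ : Fin d) (k : ℕ) (ν : Fin d) (x : Tor (fine (lev L k) M)) : Matrix.unitaryGroup n ℂ :=
  uphase (tw L M θ ν₀ μ₀ k ν x)

variable {θ : ℝ} {ν₀ μ₀ : Fin d}

omit [NeZero L] hM in
/-- `|t_k(ν, x)| ≤ |θ|/c_k`. [folklore] -/
theorem abs_tw_le (k : ℕ) (ν : Fin d) (x : Tor (fine (lev L k) M)) : |tw L M θ ν₀ μ₀ k ν x| ≤ |θ| / (lev L k : ℕ) := by
  unfold tw
  split_ifs
  · rw [abs_mul, abs_div, Nat.abs_cast]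
    exact mul_le_of_le_one_right (by positivity) (abs_cang_le _ _)
  · rw [abs_zero]; positivity

omit [NeZero L] hM in
/-- the `μ₀`-coordinate of a shifted site: `(x + e_λ)_{μ₀} = x_{μ₀} + [λ = μ₀]`. [folklore] -/
theorem shift_coord (k : ℕ) (lam : Fin d) (x : Tor (fine (lev L k) M)) :
    (x + unitVec (fine (lev L k) M) lam) μ₀ = x μ₀ + (if lam = μ₀ then 1 else 0) := by
  rw [Pi.add_apply, unitVec]
  by_cases h : lam = μ₀
  · subst h; rw [Pi.single_eq_same, if_pos rfl]
  · rw [Pi.single_eq_of_ne (Ne.symm h), if_neg h]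

/-- one lattice step changes the profile by at most `2π|θ|/(c_k²·M_{μ₀})`. [folklore] -/
theorem abs_tw_shift_sub_le (k : ℕ) (ν lam : Fin d) (x : Tor (fine (lev L k) M)) :
    |tw L M θ ν₀ μ₀ k ν (x + unitVec _ lam) - tw L M θ ν₀ μ₀ k ν x| ≤ 2 * π * |θ| / ((((lev L k : ℕ) : ℝ)) ^ 2 * (M μ₀ : ℝ)) := by
  have hℓ : (0 : ℝ) < (lev L k : ℕ) := lev_pos L k
  have hMμ : (0 : ℝ) < (M μ₀ : ℝ) := by exact_mod_cast Nat.pos_of_ne_zero (NeZero.ne (M μ₀))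
  unfold tw
  split_ifs with hν
  · rw [← mul_sub, abs_mul, abs_div, Nat.abs_cast, shift_coord]
    split_ifs with hlam
    · have h1 := abs_cang_add_one_sub_le (fine (lev L k) M μ₀) (x μ₀)
      have e1 : ((fine (lev L k) M μ₀ : ℕ) : ℝ) = ((lev L k : ℕ) : ℝ) * (M μ₀ : ℝ) := by simp only [fine]; push_cast; ring
      rw [e1] at h1
      calc |θ| / ((lev L k : ℕ) : ℝ) * |cang (fine (lev L k) M μ₀) (x μ₀ + 1) - cang (fine (lev L k) M μ₀) (x μ₀)|
          ≤ |θ| / ((lev L k : ℕ) : ℝ) * (2 * π / (((lev L k : ℕ) : ℝ) * (M μ₀ : ℝ))) := by gcongr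
        _ = 2 * π * |θ| / ((((lev L k : ℕ) : ℝ)) ^ 2 * (M μ₀ : ℝ)) := by field_simp
    · rw [add_zero, sub_self, abs_zero, mul_zero]; positivity
  · rw [sub_self, abs_zero]; positivity

end Wave

/-! ## §3 The wave lies in `RegularSites` with `α₁ = |θ|`, `β₁ = 2π|θ|/M_{μ₀}`, `β₂ = 4π²(|θ| + θ²)/M_{μ₀}²` -/

section Letters

variable {n : Type} [Fintype n] [DecidableEq n] {d : ℕ}

/-- second difference of unit phases: `|e^{ia} − 2e^{ib} + e^{ic}| ≤ |a − b|·|b − c| + |a − 2b + c|`. [folklore] -/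
theorem norm_cexp_second_diff_le (a b c : ℝ) :
    ‖Complex.exp (Complex.I * a) - Complex.exp (Complex.I * b) - Complex.exp (Complex.I * b) + Complex.exp (Complex.I * c)‖
      ≤ |a - b| * |b - c| + |a - 2 * b + c| := by
  have h1 : Complex.exp (Complex.I * b) * Complex.exp (Complex.I * ((a - b : ℝ) : ℂ)) = Complex.exp (Complex.I * a) := by
    rw [← Complex.exp_add]; congr 1; push_cast; ring
  have h3 : Complex.exp (Complex.I * c) * Complex.exp (Complex.I * ((b - c : ℝ) : ℂ)) = Complex.exp (Complex.I * b) := by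
    rw [← Complex.exp_add]; congr 1; push_cast; ring
  have e : Complex.exp (Complex.I * a) - Complex.exp (Complex.I * b) - Complex.exp (Complex.I * b) + Complex.exp (Complex.I * c)
      = (Complex.exp (Complex.I * b) - Complex.exp (Complex.I * c)) * (Complex.exp (Complex.I * ((a - b : ℝ) : ℂ)) - 1)
        + Complex.exp (Complex.I * c) * (Complex.exp (Complex.I * ((a - b : ℝ) : ℂ)) - Complex.exp (Complex.I * ((b - c : ℝ) : ℂ))) := by
    linear_combination -h1 + h3
  rw [e]
  refine (norm_add_le _ _).trans (add_le_add ?_ ?_)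
  · rw [norm_mul, mul_comm]
    refine mul_le_mul ?_ (norm_cexp_I_mul_sub_cexp_I_mul_le b c) (norm_nonneg _) (abs_nonneg _)
    exact (Real.norm_exp_I_mul_ofReal_sub_one_le).trans (le_of_eq (Real.norm_eq_abs _))
  · rw [norm_mul, Complex.norm_exp_I_mul_ofReal, one_mul]
    refine (norm_cexp_I_mul_sub_cexp_I_mul_le _ _).trans (le_of_eq ?_)
    congr 1; ring

variable (L : ℕ) [NeZero L] (M : Fin d → ℕ) [hM : ∀ μ, NeZero (M μ)] {θ : ℝ} {ν₀ μ₀ : Fin d}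

/-- the scalar phase of the wave. [folklore] -/
def cph (θ : ℝ) (ν₀ μ₀ : Fin d) (k : ℕ) (ν : Fin d) (x : Tor (fine (lev L k) M)) : ℂ := Complex.exp (Complex.I * tw L M θ ν₀ μ₀ k ν x)

omit [NeZero L] hM in
/-- the bond variables of the wave are `cph·1`. [folklore] -/
theorem cwave_coe (k : ℕ) (ν : Fin d) (x : Tor (fine (lev L k) M)) :
    ((cwave (n := n) L M θ ν₀ μ₀ k ν x : Matrix.unitaryGroup n ℂ) : Matrix n n ℂ) = cph L M θ ν₀ μ₀ k ν x • (1 : Matrix n n ℂ) := rfl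

omit [NeZero L] hM in
/-- the connection reading of the wave: `wT = c_k·(cph − 1)·1`. [folklore] -/
theorem wT_cwave (k : ℕ) (ν : Fin d) (i : idx L M k) :
    wT L M (fun k ν x => ((cwave (n := n) L M θ ν₀ μ₀ k ν x : Matrix.unitaryGroup n ℂ) : Matrix n n ℂ)) k ν i
      = (((lev L k : ℕ) : ℂ) * (cph L M θ ν₀ μ₀ k ν i.1 - 1)) • (1 : Matrix n n ℂ) := by
  rw [wT]
  show ((lev L k : ℕ) : ℂ) • (cph L M θ ν₀ μ₀ k ν i.1 • (1 : Matrix n n ℂ) - 1) = _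
  rw [← smul_smul, sub_smul, one_smul]

omit [NeZero L] hM in
/-- `wT(τ_λ i) − wT(i) = c_k·(cph(x + e_λ) − cph(x))·1`. [folklore] -/
theorem wT_cwave_tau_sub (k : ℕ) (ν lam : Fin d) (i : idx L M k) :
    wT L M (fun k ν x => ((cwave (n := n) L M θ ν₀ μ₀ k ν x : Matrix.unitaryGroup n ℂ) : Matrix n n ℂ)) k ν (tau (fine (lev L k) M) lam i)
      - wT L M (fun k ν x => ((cwave (n := n) L M θ ν₀ μ₀ k ν x : Matrix.unitaryGroup n ℂ) : Matrix n n ℂ)) k ν i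
      = (((lev L k : ℕ) : ℂ) * (cph L M θ ν₀ μ₀ k ν (i.1 + unitVec _ lam) - cph L M θ ν₀ μ₀ k ν i.1)) • (1 : Matrix n n ℂ) := by
  rw [wT_cwave, wT_cwave, ← sub_smul]
  congr 1
  simp only [BlockPairingGeometry.tau]
  ring

/-- `|cph(x + e_λ) − cph(x)| ≤ 2π|θ|/(c_k²·M_{μ₀})`. [folklore] -/
theorem norm_cph_shift_sub_le (k : ℕ) (ν lam : Fin d) (x : Tor (fine (lev L k) M)) :
    ‖cph L M θ ν₀ μ₀ k ν (x + unitVec _ lam) - cph L M θ ν₀ μ₀ k ν x‖ ≤ 2 * π * |θ| / ((((lev L k : ℕ) : ℝ)) ^ 2 * (M μ₀ : ℝ)) :=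
  (norm_cexp_I_mul_sub_cexp_I_mul_le _ _).trans (abs_tw_shift_sub_le L M k ν lam x)

/-- **THE WAVE IS IN THE (3.35)+(3.36)-SHAPE CLASS**: `RegularSites L M V |θ| (2π|θ|/M_{μ₀}) (4π²(|θ| + θ²)/M_{μ₀}²)` for `M_{μ₀} ≥ 3`. [folklore] -/
theorem regularSites_cwave [Nonempty n] (hM3 : 3 ≤ M μ₀) :
    RegularSites L M (fun k ν x => ((cwave (n := n) L M θ ν₀ μ₀ k ν x : Matrix.unitaryGroup n ℂ) : Matrix n n ℂ))
      |θ| (2 * π * |θ| / (M μ₀ : ℝ)) (4 * π ^ 2 * (|θ| + θ ^ 2) / (M μ₀ : ℝ) ^ 2) where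
  nonneg := ⟨abs_nonneg θ, by positivity, by positivity⟩
  size k ν i := by
    have hℓ : (0 : ℝ) < (lev L k : ℕ) := lev_pos L k
    rw [wT_cwave, norm_smul_one_eq, norm_mul, Complex.norm_natCast]
    calc ((lev L k : ℕ) : ℝ) * ‖cph L M θ ν₀ μ₀ k ν i.1 - 1‖ ≤ ((lev L k : ℕ) : ℝ) * (|θ| / (lev L k : ℕ)) := by
          refine mul_le_mul_of_nonneg_left ?_ hℓ.le
          exact (Real.norm_exp_I_mul_ofReal_sub_one_le).trans ((le_of_eq (Real.norm_eq_abs _)).trans (abs_tw_le L M k ν i.1))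
      _ = |θ| := by field_simp
  lipschitz k ν lam i := by
    have hℓ : (0 : ℝ) < (lev L k : ℕ) := lev_pos L k
    have hMμ : (0 : ℝ) < (M μ₀ : ℝ) := by exact_mod_cast Nat.pos_of_ne_zero (NeZero.ne (M μ₀))
    rw [wT_cwave_tau_sub, norm_smul_one_eq, norm_mul, Complex.norm_natCast]
    calc ((lev L k : ℕ) : ℝ) * ‖cph L M θ ν₀ μ₀ k ν (i.1 + unitVec _ lam) - cph L M θ ν₀ μ₀ k ν i.1‖
        ≤ ((lev L k : ℕ) : ℝ) * (2 * π * |θ| / ((((lev L k : ℕ) : ℝ)) ^ 2 * (M μ₀ : ℝ))) :=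
          mul_le_mul_of_nonneg_left (norm_cph_shift_sub_le L M k ν lam i.1) hℓ.le
      _ = 2 * π * |θ| / (M μ₀ : ℝ) / (lev L k : ℕ) := by field_simp
  lipschitz₂ k lam ν ρ i := by
    have hℓ1 : (1 : ℝ) ≤ (lev L k : ℕ) := by exact_mod_cast one_le_lev' L k
    have hℓ : (0 : ℝ) < (lev L k : ℕ) := by linarith
    have hMμ : (0 : ℝ) < (M μ₀ : ℝ) := by exact_mod_cast Nat.pos_of_ne_zero (NeZero.ne (M μ₀))
    -- the difference of the quotients is `c_k²·S·1`, `S` a second difference of `cph`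
    have hD : ∀ j : idx L M k, DqT L M (fun k ν x => ((cwave (n := n) L M θ ν₀ μ₀ k ν x : Matrix.unitaryGroup n ℂ) : Matrix n n ℂ)) lam k ν j
        = ((((lev L k : ℕ) : ℂ)) * (((lev L k : ℕ) : ℂ) * (cph L M θ ν₀ μ₀ k ν (j.1 + unitVec _ lam) - cph L M θ ν₀ μ₀ k ν j.1))) • (1 : Matrix n n ℂ) := by
      intro j; rw [DqT, wT_cwave_tau_sub, smul_smul]
    rw [hD, hD, ← sub_smul, ← mul_sub, ← mul_sub, norm_smul_one_eq, norm_mul, norm_mul, Complex.norm_natCast]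
    simp only [BlockPairingGeometry.tau]
    -- case analysis on the directions
    set x := i.1 with hx
    have key : ‖cph L M θ ν₀ μ₀ k ν (x + unitVec _ ρ + unitVec _ lam) - cph L M θ ν₀ μ₀ k ν (x + unitVec _ ρ)
          - (cph L M θ ν₀ μ₀ k ν (x + unitVec _ lam) - cph L M θ ν₀ μ₀ k ν x)‖ ≤ 4 * π ^ 2 * (|θ| + θ ^ 2) / ((M μ₀ : ℝ) ^ 2 * ((lev L k : ℕ) : ℝ) ^ 3) := by
      by_cases hν : ν = ν₀
      · by_cases hlam : lam = μ₀
        · by_cases hρ : ρ = μ₀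
          · -- the genuine second difference along `μ₀`
            have hm3 : 3 ≤ fine (lev L k) M μ₀ := le_trans hM3 (Nat.le_mul_of_pos_left _ (one_le_lev' L k))
            have hmR : ((fine (lev L k) M μ₀ : ℕ) : ℝ) = ((lev L k : ℕ) : ℝ) * (M μ₀ : ℝ) := by simp only [fine]; push_cast; ring
            have hm0 : (0 : ℝ) < ((fine (lev L k) M μ₀ : ℕ) : ℝ) := by rw [hmR]; positivity
            have hv1 : (1 : ZMod (fine (lev L k) M μ₀)).val = 1 := by
              rw [ZMod.val_one_eq_one_mod]; exact Nat.mod_eq_of_lt (by omega)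
            have hv2 : (2 : ZMod (fine (lev L k) M μ₀)).val = 2 := by
              rw [ZMod.val_two_eq_two_mod]; exact Nat.mod_eq_of_lt (by omega)
            have e1 : (x + unitVec (fine (lev L k) M) ρ + unitVec (fine (lev L k) M) lam) μ₀ = x μ₀ + 1 + 1 := by
              rw [shift_coord, shift_coord, if_pos hρ, if_pos hlam]
            have e2 : (x + unitVec (fine (lev L k) M) ρ) μ₀ = x μ₀ + 1 := by rw [shift_coord, if_pos hρ]
            have e3 : (x + unitVec (fine (lev L k) M) lam) μ₀ = x μ₀ + 1 := by rw [shift_coord, if_pos hlam]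
            have c0 : cang (fine (lev L k) M μ₀) (x μ₀) = Real.cos (2 * π * ((x μ₀).val : ℝ) / ((fine (lev L k) M μ₀ : ℕ) : ℝ)) := rfl
            have c1 : cang (fine (lev L k) M μ₀) (x μ₀ + 1)
                = Real.cos (2 * π * ((x μ₀).val : ℝ) / ((fine (lev L k) M μ₀ : ℕ) : ℝ) + 2 * π / ((fine (lev L k) M μ₀ : ℕ) : ℝ)) := by
              rw [cang_add, hv1]; congr 1; push_cast; ring
            have c2 : cang (fine (lev L k) M μ₀) (x μ₀ + 1 + 1)
                = Real.cos (2 * π * ((x μ₀).val : ℝ) / ((fine (lev L k) M μ₀ : ℕ) : ℝ) + 2 * (2 * π / ((fine (lev L k) M μ₀ : ℕ) : ℝ))) := by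
              rw [add_assoc, one_add_one_eq_two, cang_add, hv2]; congr 1; push_cast; ring
            simp only [cph, tw, if_pos hν, e1, e2, e3, c0, c1, c2]
            set α : ℝ := 2 * π * ((x μ₀).val : ℝ) / ((fine (lev L k) M μ₀ : ℕ) : ℝ) with hα
            set h : ℝ := 2 * π / ((fine (lev L k) M μ₀ : ℕ) : ℝ) with hh
            set g : ℝ := θ / ((lev L k : ℕ) : ℝ) with hg
            have hgabs : |g| = |θ| / (lev L k : ℕ) := by rw [hg, abs_div, Nat.abs_cast]
            have hh1 : 0 ≤ h := by positivity
            have hstep : ∀ u : ℝ, |g * Real.cos (u + h) - g * Real.cos u| ≤ |θ| / (lev L k : ℕ) * h := by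
              intro u
              rw [← mul_sub, abs_mul, hgabs]
              refine mul_le_mul_of_nonneg_left ?_ (by positivity)
              refine (Real.abs_cos_sub_cos_le _ _).trans (le_of_eq ?_)
              rw [show u + h - u = h by ring, abs_of_nonneg hh1]
            have hsec : |g * Real.cos (α + 2 * h) - 2 * (g * Real.cos (α + h)) + g * Real.cos α| ≤ |θ| / (lev L k : ℕ) * h ^ 2 := by
              rw [show g * Real.cos (α + 2 * h) - 2 * (g * Real.cos (α + h)) + g * Real.cos α
                = g * (Real.cos (α + 2 * h) - 2 * Real.cos (α + h) + Real.cos α) by ring, abs_mul, hgabs]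
              exact mul_le_mul_of_nonneg_left (abs_cos_second_diff_le α h) (by positivity)
            have hmain := norm_cexp_second_diff_le (g * Real.cos (α + 2 * h)) (g * Real.cos (α + h)) (g * Real.cos α)
            have hA := hstep (α + h)
            rw [show α + h + h = α + 2 * h by ring] at hA
            have hB := hstep α
            have hθ0 : 0 ≤ |θ| / (lev L k : ℕ) * h := by positivity
            rw [show Complex.exp (Complex.I * ↑(g * Real.cos (α + 2 * h))) - Complex.exp (Complex.I * ↑(g * Real.cos (α + h)))
                - (Complex.exp (Complex.I * ↑(g * Real.cos (α + h))) - Complex.exp (Complex.I * ↑(g * Real.cos α)))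
                = Complex.exp (Complex.I * ↑(g * Real.cos (α + 2 * h))) - Complex.exp (Complex.I * ↑(g * Real.cos (α + h)))
                  - Complex.exp (Complex.I * ↑(g * Real.cos (α + h))) + Complex.exp (Complex.I * ↑(g * Real.cos α)) by ring]
            refine hmain.trans ?_
            have hh2 : h = 2 * π / (((lev L k : ℕ) : ℝ) * (M μ₀ : ℝ)) := by rw [hh, hmR]
            calc |g * Real.cos (α + 2 * h) - g * Real.cos (α + h)| * |g * Real.cos (α + h) - g * Real.cos α|
                  + |g * Real.cos (α + 2 * h) - 2 * (g * Real.cos (α + h)) + g * Real.cos α|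
                ≤ (|θ| / (lev L k : ℕ) * h) * (|θ| / (lev L k : ℕ) * h) + |θ| / (lev L k : ℕ) * h ^ 2 := by
                  gcongr
              _ = (θ ^ 2 / ((lev L k : ℕ) : ℝ) ^ 2 + |θ| / (lev L k : ℕ)) * h ^ 2 := by rw [← sq_abs θ]; ring
              _ ≤ (θ ^ 2 / (lev L k : ℕ) + |θ| / (lev L k : ℕ)) * h ^ 2 := by
                  have hq : θ ^ 2 / ((lev L k : ℕ) : ℝ) ^ 2 ≤ θ ^ 2 / (lev L k : ℕ) :=
                    div_le_div_of_nonneg_left (sq_nonneg θ) hℓ (by nlinarith [hℓ1])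
                  nlinarith [sq_nonneg h]
              _ = 4 * π ^ 2 * (|θ| + θ ^ 2) / ((M μ₀ : ℝ) ^ 2 * ((lev L k : ℕ) : ℝ) ^ 3) := by rw [hh2]; field_simp; ring
          · -- `ρ ≠ μ₀`: the two first differences coincide
            have e1 : (x + unitVec (fine (lev L k) M) ρ + unitVec (fine (lev L k) M) lam) μ₀ = x μ₀ + 1 := by
              rw [shift_coord, shift_coord, if_neg hρ, if_pos hlam, add_zero]
            have e2 : (x + unitVec (fine (lev L k) M) ρ) μ₀ = x μ₀ := by rw [shift_coord, if_neg hρ, add_zero]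
            have e3 : (x + unitVec (fine (lev L k) M) lam) μ₀ = x μ₀ + 1 := by rw [shift_coord, if_pos hlam]
            simp only [cph, tw, if_pos hν, e1, e2, e3, sub_self, norm_zero]
            positivity
        · -- `λ ≠ μ₀`: both first differences vanish
          have e1 : (x + unitVec (fine (lev L k) M) ρ + unitVec (fine (lev L k) M) lam) μ₀ = (x + unitVec (fine (lev L k) M) ρ) μ₀ := by
            rw [shift_coord (lam := lam), if_neg hlam, add_zero]
          have e3 : (x + unitVec (fine (lev L k) M) lam) μ₀ = x μ₀ := by rw [shift_coord, if_neg hlam, add_zero]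
          simp only [cph, tw, if_pos hν, e1, e3, sub_self, norm_zero]
          positivity
      · simp only [cph, tw, if_neg hν, sub_self, norm_zero]
        positivity
    calc ((lev L k : ℕ) : ℝ) * (((lev L k : ℕ) : ℝ) * ‖cph L M θ ν₀ μ₀ k ν (x + unitVec _ ρ + unitVec _ lam) - cph L M θ ν₀ μ₀ k ν (x + unitVec _ ρ)
          - (cph L M θ ν₀ μ₀ k ν (x + unitVec _ lam) - cph L M θ ν₀ μ₀ k ν x)‖)
        ≤ ((lev L k : ℕ) : ℝ) * (((lev L k : ℕ) : ℝ) * (4 * π ^ 2 * (|θ| + θ ^ 2) / ((M μ₀ : ℝ) ^ 2 * ((lev L k : ℕ) : ℝ) ^ 3))) := by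
          gcongr
      _ = 4 * π ^ 2 * (|θ| + θ ^ 2) / (M μ₀ : ℝ) ^ 2 / (lev L k : ℕ) := by field_simp

end Letters

end Summit.QuantumFields.BalabanUV.T4Continuum.NE2.RegularGaugeFieldWave

end
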